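import Literature.MathematicalPhysics.QuantumFieldTheory.Balaban1983to89.B12Lemma4ConcreteFrame
import Literature.MathematicalPhysics.QuantumFieldTheory.Balaban1983to89.B12RegularSpaces111Gauge
import Literature.MathematicalPhysics.QuantumFieldTheory.Balaban1983to89.B12Eq44Space

/-!
# `Balaban1983to89.B12Lemma4DataInstance` — T. Bałaban, *Renormalization group approach to lattice gauge field theories. I*,
Commun. Math. Phys. **109** (1987) 249–301 [Balaban1987RG1], Lemma 4 p. 280: **A MODEL INSTANCE (NON-VACUITY CERTIFICATE) of the
by-reference package `B12Lemma4ConcreteFrame.Lemma4Data` under «all the restrictions» `B12Sec2to5.Lemma4Restrictions`.**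

HONEST FRAMING (cell `lit-balaban`, verbatim): statement-level skeleton of published theorems with citation tags; proofs where landed; nothing here is a claim about the Yang–Mills mass gap.

PDF held: `paper:balaban1987-cmp109-rg-i-small-field` (journal page = PDF page + 248), p. 280 [PDF 32] (Lemma 4), pp. 275–280 (its proof).

WHY.  The SKELETON row `B12.Lem4` leads `proved` (owners r09 v2.57 / r20 v1.42) because the decl of record
`B12Sec2to5.Lemma4Printed` is proved on the concrete frame `B12Lemma4ConcreteFrame.frameOf 𝓜 c D` for EVERY package
`D : Lemma4Data P i 𝓜 c` of the proof's by-reference inputs ([15]/[14]: the functions `𝐇_j(□₀,·)`, `H_{1,j}`, `𝐀₂`, the gauge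
transformations with their printed costs, the identities (3.37)+(3.39)/(3.38)/(3.42), the sizes (3.37)/(3.45)/(3.50)/(J2)/(J3), the
further restrictions) — about sixty hypothesis fields.  A universally quantified theorem over a hypothesis STRUCTURE is only as
good as the structure is consistent: were the fields of `Lemma4Data`/`JInputs` jointly unsatisfiable, `lemma4Printed_frameOf`
would hold vacuously.  p07's `B12Lemma4Assembled.restrictions_nonvacuous` certifies the CONSTANT list; THIS module certifies the
WHOLE PACKAGE: it exhibits, for every complete normed ℂ-algebra `𝔸` with `‖1‖ = 1` and every torus `T^{(i)}`, explicit constants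
`c` satisfying `Lemma4Restrictions c` and an explicit `D : Lemma4Data P i 𝓜 c` (so `Lemma4Printed (frameOf 𝓜 c D) c` holds
NON-VACUOUSLY, `lemma4Printed_trivData`), and checks that the printed domain of the `∀` in (3.53) —
U′ᶜ_{k+1}(□₀, (1+2β)α₀, (1+2β)α₁) × (3.31) × {|B′| < α₃} × [0, 1] — is non-empty in it (`domain_nonempty`), so that the membership
conclusion (3.53) is actually exercised (`comp_mem_Ucj_witness`).  KIND: model instance / non-vacuity certificate (as r11's
`B14Eq358ModelInstance` for [III] §3); no SKELETON head depends on it.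

THE INSTANCE (deliberately the simplest one; it certifies consistency, not strength).  Value data: the FULL model
`fullModel = ⟨⊤, ⊤, ⊤⟩` (`G = Gᶜ = 𝔸ˣ`, `𝔤ᶜ = 𝔸`), `π = id` (`Cπ = 1`).  Geometry: every region (`X`, the cubes, `X̃⁻²`, `Y = □̃³`,
and those of the □₀-frame) is the whole torus `univRegion` (all plaquettes, bonds, derivative triples).  Scales: `L = 13`, `j = 1`
(`ξ = 1/13`), `k + 1 = 2` (`ξ′ = 1/169`), `η = 1/13` (so `L^jη = 1`, `ξ·L^{j−1}η = L⁻¹η = ξ′`), `O(1)LMB = 1`.  Constants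
(p07's witness of `restrictions_nonvacuous`): `B₃ = O(1) = M = 1`, `β₀ = ¾`, `β = ½`, `α₁ = 1/32`, `α₂ = 1`,
`α₀ = 1/(2(4D + 64))`, `α₃ = α₀/1352` with `D = (d − 1)·C_F(1)` (`C_F(1) = B12Eq311CurrentExpansion.C311 1 ≥ 0`, the coefficient of
the J-restriction `hresJ`), `B₃″ = 1`, `γ₀′ = 1`.  (iv)-data: `U_n(M˙(V)) = V`, `J_n(M˙(V)) = J_{(L^n)⁻¹}(V)` (the current (1.8) at scale
`(Lⁿ)⁻¹`, `echoBg`).  [15]-letters: `𝐊 = 𝐀₂ = 0` (so `V = exp iξ·0 = 1`), and in every `JInputs` package `Φ₀ = (1, 0)` (the unit pair,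
`B12RegularSpaces111Mono.unitPair`), `𝐇 = H₁ = 0`, `ℓ = 0`, `u_j = ū_{k+1} = v_j = v = ū_j = w₁ = 1`, `ctr = id`; the (3.31)-set
`A331 = univ`, `|B′| = ‖B′‖`.  Every identity field then reads `1 = 1` or `0 = 0` (`plaq_one`, `gaugeU_one`, `expI_zero`,
`current_one`, `lapCur_zero`), every size field `0 < (positive constant)` or `0 ≤ B₃‖B′‖`, every cost field `1 ≤ e^{(nonneg)}`.

WHAT IS PROVED (definitions with bodies + theorems; no new `Prop`-fact, no sorry): §1 `fullModel`, `univRegion`, `echoBg`,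
`univFrame`, `csLow`, `csUp`, `consts`; §2 (private `C311_one_nonneg`, `coefD_nonneg`), `lemma4Restrictions_consts` (+ the six extra
restrictions `consts_extra`, positivity of `α₀, α₁, α₃, β`); §3 (private `cost_one`), `expI_zero_cfg`, `satisfies_unitPair` (the unit pair
satisfies (i)–(iv) on the instance's frames), `trivInputs` (a `JInputs` package for every value of the variables); §4 `trivData : Lemma4Data`;
§5 `lemma4Printed_trivData`, `domain_nonempty`, `comp_mem_Ucj_witness`, **`lemma4Data_nonvacuous`** (∃ 𝓜 c D, restrictions ∧
the printed domain is inhabited).  Unit `lit-balaban-r20` (B12 fold owner, gen 10; TAKING line HOME/STATUS.md 2026-08-21T20:33:34Z),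
HOME `run/shared/lean/pub/lit-balaban/`.
-/

open NormedSpace Complex

namespace Literature.MathematicalPhysics.QuantumFieldTheory.Balaban1983to89.B12Lemma4DataInstance

open Literature.MathematicalPhysics.QuantumFieldTheory.Balaban1983to89
open Literature.MathematicalPhysics.QuantumFieldTheory.Balaban1983to89.B9Eq39Adjoint (R)
open Literature.MathematicalPhysics.QuantumFieldTheory.Balaban1983to89.B12Eq311CurrentExpansion
open Literature.MathematicalPhysics.QuantumFieldTheory.Balaban1983to89.B12RegularSpaces111
open Literature.MathematicalPhysics.QuantumFieldTheory.Balaban1983to89.B12RegularSpaces111Mono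
open Literature.MathematicalPhysics.QuantumFieldTheory.Balaban1983to89.B12RegularSpaces111Gauge (gaugeU_one)
open Literature.MathematicalPhysics.QuantumFieldTheory.Balaban1983to89.B12Eq18Current
open Literature.MathematicalPhysics.QuantumFieldTheory.Balaban1983to89.B12Lemma4ConcreteFrame

noncomputable section

variable {P : Params} {i : ℕ} {𝔸 : Type} [NormedRing 𝔸] [NormedAlgebra ℂ 𝔸] [CompleteSpace 𝔸]

/-! ## §1. The data of the instance -/

/-- The FULL value model: `G = Gᶜ = 𝔸ˣ`, `𝔤ᶜ = 𝔸` (every closure property of the package holds trivially).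
[cite: Balaban1987RG1, (1.10) p.262] -/
def fullModel : Model 𝔸 := ⟨⊤, ⊤, ⊤⟩

/-- The whole torus as a region: all plaquettes, all bonds, all derivative triples. [cite: Balaban1987RG1, (1.11)-(1.14) p.262] -/
def univRegion : Region P i := ⟨Set.univ, Set.univ, Set.univ⟩

/-- The (iv)-data of the instance: `U_n(M˙(V)) = V` and `J_n(M˙(V)) = J_{(Lⁿ)⁻¹}(V)`, the current (1.8) of `V` at scale `(Lⁿ)⁻¹` with
`π = id`. [cite: Balaban1987RG1, (1.15) p.262] -/
def echoBg (cs : StepConsts) : BackgroundFns P i 𝔸 :=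
  ⟨fun _ V => V, fun n V => current (LinearMap.id : 𝔸 →ₗ[ℂ] 𝔸) (cs.L ^ n)⁻¹ V⟩

/-- The frame of the instance: `X = X̃⁻² =` the whole torus, every region a «cube», (iv)-data `echoBg`.
[cite: Balaban1987RG1, (1.11)-(1.16) p.262] -/
def univFrame (cs : StepConsts) : Frame P i 𝔸 := ⟨univRegion, Set.univ, univRegion, echoBg cs⟩

/-- The constants of the lower frame (`X`, scale `j = 1`): `ξ = 1/13`, `L = 13`, `O(1)LMB = 1`. [cite: Balaban1987RG1, (1.11) p.262] -/
def csLow : StepConsts := ⟨1, 1 / 13, 13, 1⟩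

/-- The constants of the upper frame (`□₀`, scale `k + 1 = 2`): `ξ′ = 1/169 = L⁻¹η`, `L = 13`, `O(1)LMB = 1`.
[cite: Balaban1987RG1, (3.40) p.278] -/
def csUp : StepConsts := ⟨2, 1 / 169, 13, 1⟩

/-- The constants of the instance (p07's witness of `B12Lemma4Assembled.restrictions_nonvacuous`): `B₃ = O(1) = M = 1`, `L = 13`,
`β₀ = ¾`, `β = ½`, `α₀ = 1/(2(4D + 64))`, `α₁ = 1/32`, `α₂ = 1`, `α₃ = α₀/1352`. [cite: Balaban1987RG1, Lemma 4 p.280] -/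
def consts (D : ℝ) : B12Sec2to5.Lemma4Consts :=
  ⟨1, 1, 1, 13, 3 / 4, 1 / 2, 1 / (2 * (4 * D + 64)), 1 / 32, 1, 1 / (2 * (4 * D + 64)) / 1352⟩

/-! ## §2. The constants satisfy «all the restrictions» -/

omit [CompleteSpace 𝔸] in
/-- OUR absolute constant `C_F(1)` of the (3.11)-remainder bound is nonnegative. [folklore] -/
private theorem C311_one_nonneg : 0 ≤ C311 (1 : ℝ) := by
  unfold C311 KI KQ KR
  positivity

/-- The coefficient `D = (d − 1)·Cπ·C_F(1)` of the J-restriction (`Cπ = 1`) is nonnegative (`d ≥ 1`). [folklore] -/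
private theorem coefD_nonneg (P : Params) : 0 ≤ ((P.d : ℝ) - 1) * (1 * C311 (1 : ℝ)) := by
  have hd : (1 : ℝ) ≤ (P.d : ℝ) := by exact_mod_cast P.hd
  have := C311_one_nonneg
  have h1 : 0 ≤ (P.d : ℝ) - 1 := by linarith
  positivity

/-- **«all the restrictions» hold for the constants of the instance** (`D ≥ 0`). [cite: Balaban1987RG1, Lemma 4 p.280] -/
theorem lemma4Restrictions_consts {D : ℝ} (hD : 0 ≤ D) : B12Sec2to5.Lemma4Restrictions (consts D) := by
  have hT : 0 < 2 * (4 * D + 64) := by positivity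
  unfold B12Sec2to5.Lemma4Restrictions consts
  have hα₀ : 0 < 1 / (2 * (4 * D + 64)) := by positivity
  have hα₀' : 1 / (2 * (4 * D + 64)) ≤ 1 / 128 :=
    one_div_le_one_div_of_le (by norm_num) (by nlinarith)
  refine ⟨hα₀, by norm_num, by norm_num, by positivity, by norm_num, by norm_num, by norm_num, by norm_num, ?_, ?_, by norm_num,
    ?_, ?_, by norm_num⟩
  · dsimp only; nlinarith
  · dsimp only; nlinarith
  · dsimp only; nlinarith
  · dsimp only
    have : (13 : ℝ)⁻¹ ^ 2 = 1 / 169 := by norm_num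
    rw [this]
    have h0 := hα₀.le
    nlinarith

/-- The six further restrictions of `Lemma4Data` for the constants of the instance: `B₃ ≥ 1`, `B₃²O(1)M ≥ 1`, `16·O(1)Mα₁ ≤ β`,
`1 + 10β ≤ L²`, `B₃″α₃ ≤ βL⁻²α₀` (`B₃″ = 1`), `4D(B₃²O(1)M)²α₀ ≤ β`. [cite: Balaban1987RG1, Lemma 4 p.280] -/
theorem consts_extra {D : ℝ} (hD : 0 ≤ D) :
    1 ≤ (consts D).B₃ ∧ 1 ≤ (consts D).B₃ ^ 2 * (consts D).O₁ * (consts D).M ∧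
      16 * ((consts D).O₁ * (consts D).M * (consts D).α₁) ≤ (consts D).β ∧ 1 + 10 * (consts D).β ≤ (consts D).L ^ 2 ∧
      1 * (consts D).α₃ ≤ (consts D).β * (consts D).L⁻¹ ^ 2 * (consts D).α₀ ∧
      4 * D * ((consts D).B₃ ^ 2 * (consts D).O₁ * (consts D).M) ^ 2 * (consts D).α₀ ≤ (consts D).β := by
  have hT : 0 < 2 * (4 * D + 64) := by positivity
  unfold consts
  refine ⟨le_rfl, by norm_num, by norm_num, by norm_num, ?_, ?_⟩
  · dsimp only
    have : (13 : ℝ)⁻¹ ^ 2 = 1 / 169 := by norm_num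
    rw [this]
    have h0 : 0 ≤ 1 / (2 * (4 * D + 64)) := by positivity
    nlinarith
  · dsimp only
    rw [show 4 * D * (1 ^ 2 * 1 * 1 : ℝ) ^ 2 * (1 / (2 * (4 * D + 64))) = 4 * D / (2 * (4 * D + 64)) by ring,
      div_le_iff₀ hT]
    nlinarith

/-- `α₀ > 0` for the constants of the instance. [cite: Balaban1987RG1, Lemma 4 p.280] -/
theorem consts_α₀_pos {D : ℝ} (hD : 0 ≤ D) : 0 < (consts D).α₀ := by
  unfold consts; dsimp only; positivity

/-- `α₁ > 0` for the constants of the instance. [cite: Balaban1987RG1, Lemma 4 p.280] -/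
theorem consts_α₁_pos (D : ℝ) : 0 < (consts D).α₁ := by
  unfold consts; norm_num

/-- `α₃ > 0` for the constants of the instance. [cite: Balaban1987RG1, Lemma 4 p.280] -/
theorem consts_α₃_pos {D : ℝ} (hD : 0 ≤ D) : 0 < (consts D).α₃ := by
  unfold consts; dsimp only; positivity

/-- `β > 0` for the constants of the instance. [cite: Balaban1987RG1, Lemma 4 p.280] -/
theorem consts_β_pos (D : ℝ) : 0 < (consts D).β := by
  unfold consts; norm_num

/-! ## §3. A `JInputs` package for every value of the variables -/

section Inputs

variable [NormOneClass 𝔸]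

omit [NormedAlgebra ℂ 𝔸] [CompleteSpace 𝔸] in
/-- A printed COST bound for the unit gauge transformation: `‖1‖·‖1⁻¹‖ = 1 ≤ e^{x}` for `x ≥ 0`. [folklore] -/
private theorem cost_one {x : ℝ} (hx : 0 ≤ x) (y : Site P i) :
    ‖((1 : Site P i → 𝔸ˣ) y : 𝔸)‖ * ‖(↑((1 : Site P i → 𝔸ˣ) y)⁻¹ : 𝔸)‖ ≤ Real.exp x := by
  simp only [Pi.one_apply, inv_one, Units.val_one, norm_one, mul_one]
  have := Real.add_one_le_exp x
  linarith

omit [NormOneClass 𝔸] in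
/-- The configuration `exp iξ·0` is the unit configuration. [cite: Balaban1987RG1, (1.13) p.262] -/
theorem expI_zero_cfg (ξ : ℝ) : (fun b : PBond P i => expI ξ ((0 : PBond P i → 𝔸) b)) = 1 := by
  funext b
  rw [Pi.zero_apply, expI_zero]
  rfl

omit [NormOneClass 𝔸] in
/-- The configuration `exp iξ(0 + 0)` is the unit configuration. [cite: Balaban1987RG1, (1.13) p.262] -/
theorem expI_zero_add_zero_cfg (ξ : ℝ) :
    (fun b : PBond P i => expI ξ ((0 : PBond P i → 𝔸) b + (0 : PBond P i → 𝔸) b)) = 1 := by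
  funext b
  rw [Pi.zero_apply, add_zero, expI_zero]
  rfl

omit [NormOneClass 𝔸] in
/-- **The unit pair satisfies the four conditions of the upper space in the instance** (`(𝐔, 𝐉′) = (1, 0)`: every printed strict
bound has left side `0`; the (iv)-data of `echoBg` send `1` to `1` and to the zero current). [cite: Balaban1987RG1, (1.11)-(1.16) p.262] -/
theorem satisfies_unitPair (cs : StepConsts) (hξ : cs.ξ ≠ 0) (hL : cs.L ≠ 0) (hcB : 0 < cs.cB) {a₀ a₁ γ₀ : ℝ}
    (h₀ : 0 < a₀) (h₁ : 0 < a₁) (hγ : 0 < γ₀) :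
    Satisfies (fullModel : Model 𝔸) (univFrame (P := P) (i := i) cs) cs a₀ a₁ γ₀ unitPair := by
  have hIV : CondIV (univFrame (P := P) (i := i) (𝔸 := 𝔸) cs).bg (univFrame (P := P) (i := i) (𝔸 := 𝔸) cs).X₂ cs a₀
      (1 : PBond P i → 𝔸ˣ) := by
    refine ⟨fun n _ _ p _ => ?_, fun n _ _ b _ => ?_⟩
    · show ‖(↑(plaq (1 : PBond P i → 𝔸ˣ) p) : 𝔸) - 1‖ < a₀ * cs.ξ ^ 2
      rw [plaq_one, Units.val_one, sub_self, norm_zero]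
      exact mul_pos h₀ (by positivity)
    · show ‖current (LinearMap.id : 𝔸 →ₗ[ℂ] 𝔸) (cs.L ^ n)⁻¹ (1 : PBond P i → 𝔸ˣ) b‖ < a₀ * (cs.L ^ n * cs.ξ) ^ 2
      rw [B12Eq44Space.current_one, norm_zero]
      exact mul_pos h₀ (by positivity)
  exact ⟨fun _ _ => Subgroup.mem_top _, fun _ _ => Submodule.mem_top, 1, fun _ => 0, factors_one cs,
    condI_one _ hξ hcB h₀, condII_zero _ cs h₁ 1, condIII_one_zero _ hξ h₀ hγ, hIV, hIV⟩

/-- **A by-reference package `JInputs` for every value of the variables, in the instance**: `Φ₀ = (1, 0)`, all [15]-functions zero,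
all gauge transformations `1`, `ctr = id`; `𝐊 = 𝐀₂ = 0`.  The identity fields are `1 = 1` / `0 = 0`, the size fields are
`0 < (positive constant)` or `0 ≤ B₃‖B′‖`, the cost fields `1 ≤ e^{(nonneg)}`. [cite: Balaban1987RG1, (3.37)-(3.52) pp.277-280] -/
def trivInputs (c : B12Sec2to5.Lemma4Consts) (hB₃ : 0 < c.B₃) (hO₁ : 0 < c.O₁) (hM : 0 < c.M) (hL1 : 1 ≤ c.L) (hβ : 0 < c.β)
    (hα₀ : 0 < c.α₀) (hα₁ : 0 < c.α₁) {η : ℝ} (hη : 0 < η) {B₃'' γ₀' : ℝ} (hB'' : 0 ≤ B₃'') (hγ : 0 < γ₀') (j : ℕ) (τ : ℝ)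
    {n : ℝ} (hn : 0 ≤ n) :
    JInputs (fullModel : Model 𝔸) c (univFrame (P := P) (i := i) csLow) (univFrame csUp) csLow csUp univRegion
      (LinearMap.id : 𝔸 →ₗ[ℂ] 𝔸) η B₃'' γ₀' j τ n 0 0 := by
  have hLpos : 0 < c.L := lt_of_lt_of_le one_pos hL1
  have hx : 0 < c.L ^ (j - 1) * η := by positivity
  have hS1 : 0 < c.B₃ ^ 2 * c.O₁ * c.M * c.α₀ * (c.L ^ (j - 1) * η) := by positivity
  have hS2 : 0 < c.B₃ * (c.B₃ * c.O₁ * c.M * c.α₀ * (c.L ^ (j - 1) * η)) ^ 2 := by positivity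
  have hS3 : 0 < c.β * c.α₀ * (c.L ^ (j - 1) * η) ^ 2 := by positivity
  refine
    { Φ₀ := unitPair
      hΦ₀ := satisfies_unitPair csUp (by norm_num [csUp]) (by norm_num [csUp]) (by norm_num [csUp])
        (by positivity) (by positivity) hγ
      H := 0, H₁ := 0, ℓ := 0, uj := 1, ubar1 := 1, vj := 1, v := 1, ubar := fun _ => 1, w₁ := fun _ => 1
      ctr := fun _ x => x
      hKgc := fun _ => Submodule.mem_top
      hAgc := fun _ => Submodule.mem_top
      huj := cost_one (by positivity)
      hubar1 := cost_one (by positivity)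
      hvj := cost_one (by positivity)
      hv := cost_one (by positivity)
      hubar := fun _ _ => rfl
      h339 := ?_, h342 := ?_, h338 := ?_, hJn := ?_, h338₁ := ?_, hJn₁ := ?_
      hH := fun b => by rw [Pi.zero_apply, norm_zero]; exact hS1
      hHd := fun μ ν y => by
        simp only [grad, Pi.zero_apply, sub_self, smul_zero, norm_zero]
        exact hS1
      h45 := fun p _ => by
        simp only [Pi.zero_apply, add_zero, sub_self, smul_zero, norm_zero]
        exact hS2
      hK := fun b => by rw [Pi.zero_apply, norm_zero]; exact hS1
      hKd := fun μ ν y => by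
        simp only [grad, Pi.zero_apply, sub_self, smul_zero, norm_zero]
        exact hS1
      h45τ := fun p _ => by
        simp only [Pi.zero_apply, add_zero, sub_self, smul_zero, norm_zero]
        exact hS2
      hA := fun b => by rw [Pi.zero_apply, norm_zero]; positivity
      hAd := fun μ ν y => by
        simp only [grad, Pi.zero_apply, sub_self, smul_zero, norm_zero]
        positivity
      hS := fun b _ => by
        rw [sub_zero, B12CondIIIJConcreteModels.lapCur_zero, norm_zero]
        exact hS3
      hSτ := fun b _ => by
        rw [smul_zero, sub_zero, B12CondIIIJConcreteModels.lapCur_zero, norm_zero]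
        exact hS3
      hA2 := fun b _ => by
        rw [B12CondIIIJConcreteModels.lapCur_zero, norm_zero]
        positivity }
  · -- (3.39)+(3.37): both plaquette variables are those of the unit configuration
    intro p _
    rw [expI_zero_cfg]
    simp only [mul_one, inv_one, gaugeU_one]
    rfl
  · -- (3.42): both sides vanish (`J(1) = 0`)
    intro b _
    rw [expI_zero_cfg, B12Eq44Space.current_one]
    simp only [mul_one, inv_one]
    show (0 : 𝔸) = ((1 : Site P i → 𝔸ˣ) b.src : 𝔸) *
      ((((c.L ^ (j - 1) * η : ℝ) : ℂ) ^ 3) • current (LinearMap.id : 𝔸 →ₗ[ℂ] 𝔸) (csUp.L ^ csUp.j)⁻¹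
        (unitPair (P := P) (i := i) (𝔸 := 𝔸)).U b) * ↑(((1 : Site P i → 𝔸ˣ) b.src)⁻¹ : 𝔸ˣ)
    have hU : (unitPair (P := P) (i := i) (𝔸 := 𝔸)).U = (1 : PBond P i → 𝔸ˣ) := rfl
    rw [hU, B12Eq44Space.current_one, smul_zero, mul_zero, zero_mul]
  · -- (3.38) for `V`: `U_m(M˙(V)) = V = V^1`
    intro m _ _ p _
    simp only [inv_one, mul_one, gaugeU_one]
    rfl
  · -- (3.38), current half, for `V`
    intro m _ _ b _
    simp only [inv_one, mul_one, gaugeU_one]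
    rfl
  · -- (3.38) for `1`
    intro m _ _ p _
    simp only [gaugeU_one]
    rfl
  · -- (3.38), current half, for `1`
    intro m _ _ b _
    simp only [gaugeU_one]
    rfl

end Inputs

/-! ## §4. The package `Lemma4Data` of the instance -/

section Data

variable [NormOneClass 𝔸]

/-- **The `Lemma4Data` of the instance** over the full model with the constants `consts D`, `D = (d − 1)·1·C_F(1)`: frames = the whole
torus at scales `j = 1` and `k + 1 = 2`, `Y` = the whole torus, `π = id`, `Cπ = 1`, `η = 1/13`, `B₃″ = 1`, `γ₀′ = 1`, (3.31)-set = all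
fields, `|B′| = ‖B′‖`, `𝐊 = 𝐀₂ = 0`, and the package `trivInputs` at every value of the variables.
[cite: Balaban1987RG1, Lemma 4 (3.53) p.280 with (3.26)-(3.52) pp.275-280] -/
def trivData (P : Params) (i : ℕ) :
    Lemma4Data P i (fullModel : Model 𝔸) (consts (((P.d : ℝ) - 1) * (1 * C311 (1 : ℝ)))) where
  F := univFrame csLow
  cs := csLow
  F' := univFrame csUp
  cs' := csUp
  Y := univRegion
  π := LinearMap.id
  Cπ := 1
  η := 1 / 13
  j := 1
  B₃'' := 1
  γ₀' := 1
  A331 := Set.univ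
  normB := fun B => ‖B‖
  K := fun _ _ _ => 0
  A₂ := fun _ _ _ _ => 0
  hB := (consts_extra (coefD_nonneg P)).1
  hY := (consts_extra (coefD_nonneg P)).2.1
  hα₁ := (consts_extra (coefD_nonneg P)).2.2.1
  hL10 := (consts_extra (coefD_nonneg P)).2.2.2.1
  hB'' := zero_le_one
  hres'' := (consts_extra (coefD_nonneg P)).2.2.2.2.1
  hresJ := (consts_extra (coefD_nonneg P)).2.2.2.2.2
  hξ := by norm_num [csLow]
  hξ1 := by norm_num [csLow]
  hcB := by norm_num [csLow]
  hL := by norm_num [csLow]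
  hLξ := by norm_num [csLow]
  hη := by norm_num
  hj := le_rfl
  hscale := by norm_num [consts]
  hξx := by norm_num [csLow, consts]
  hj' := by norm_num [csUp]
  hLξ' := by norm_num [csUp]
  hξ' := by norm_num [csUp, consts]
  heGc := fun _ _ => Subgroup.mem_top _
  hπ := fun _ => Submodule.mem_top
  hgc := fun _ _ _ _ => Submodule.mem_top
  hπR := fun _ _ => rfl
  hCπ := zero_le_one
  hπn := fun X => by rw [LinearMap.id_apply, one_mul]
  hXb := fun _ _ => Set.mem_univ _
  hXd := fun _ _ => Set.mem_univ _
  hX₂b := fun _ _ => Set.mem_univ _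
  hX₂p := fun _ _ => Set.mem_univ _
  hXp' := fun _ _ => Set.mem_univ _
  hYb' := fun _ _ => Set.mem_univ _
  hXp := fun _ _ => ⟨Set.mem_univ _, Set.mem_univ _, Set.mem_univ _, Set.mem_univ _, Set.mem_univ _, Set.mem_univ _⟩
  inputs := fun _ _ τ B' _ _ _ _ _ =>
    trivInputs _ (by norm_num [consts]) (by norm_num [consts]) (by norm_num [consts]) (by norm_num [consts])
      (consts_β_pos _) (consts_α₀_pos (coefD_nonneg P)) (consts_α₁_pos _) (by norm_num) zero_le_one one_pos 1 τ
      (norm_nonneg B')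
  hKan := fun _ _ _ _ _ _ _ _ => analyticAt_const
  hA2an := fun _ _ _ _ _ _ _ _ => analyticAt_const

end Data

/-! ## §5. Non-vacuity: Lemma 4 on the instance, and the printed domain is inhabited -/

section Nonvacuity

variable [NormOneClass 𝔸]

/-- **Lemma 4 (3.53), the decl of record `B12Sec2to5.Lemma4Printed`, holds on the instance** — non-vacuously, its restriction
hypothesis being met (`lemma4Restrictions_consts`). [cite: Balaban1987RG1, Lemma 4 (3.53) p.280] -/
theorem lemma4Printed_trivData (P : Params) (i : ℕ) :
    B12Sec2to5.Lemma4Printed (frameOf fullModel _ (trivData (𝔸 := 𝔸) P i))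
      (consts (((P.d : ℝ) - 1) * (1 * C311 (1 : ℝ)))) :=
  lemma4Printed_frameOf _

/-- **The printed domain of (3.53) is inhabited in the instance**: the unit pair lies in U′ᶜ_{k+1}(□₀, (1+2β)α₀, (1+2β)α₁), the zero
field in the (3.31)-set, and `B′ = 0` has `|B′| < α₃`. [cite: Balaban1987RG1, Lemma 4 (3.53) p.280] -/
theorem domain_nonempty (P : Params) (i : ℕ) :
    let c := consts (((P.d : ℝ) - 1) * (1 * C311 (1 : ℝ)))
    let Fr := frameOf fullModel c (trivData (𝔸 := 𝔸) P i)
    (unitPair : FieldPair P i 𝔸ˣ 𝔸) ∈ Fr.Uprime ((1 + 2 * c.β) * c.α₀) ((1 + 2 * c.β) * c.α₁) ∧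
      (0 : PBond P i → 𝔸) ∈ Fr.A331 ∧ Fr.normB (0 : PBond P i → 𝔸) < c.α₃ := by
  have hD := coefD_nonneg P
  have hβ := consts_β_pos (((P.d : ℝ) - 1) * (1 * C311 (1 : ℝ)))
  refine ⟨?_, ?_, ?_⟩
  · exact mem_Uprime_frameOf_of_satisfies _
      (satisfies_unitPair csUp (by norm_num [csUp]) (by norm_num [csUp]) (by norm_num [csUp])
        (mul_pos (by linarith) (consts_α₀_pos hD)) (mul_pos (by linarith) (consts_α₁_pos _)) one_pos)
  · exact Set.mem_univ (0 : PBond P i → 𝔸)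
  · show ‖(0 : PBond P i → 𝔸)‖ < _
    rw [norm_zero]
    exact consts_α₃_pos hD

/-- **The membership conclusion (3.53) exercised**: in the instance, at `𝐔 = (1, 0)`, `𝐀 = 0`, `τ = 0`, `B′ = 0`, the composite
configuration `(V, J(V))` lies in `U^c_j(X, α₀, α₁)` — obtained BY APPLYING Lemma 4 on the instance (`comp_mem_Ucj`), not by hand.
[cite: Balaban1987RG1, Lemma 4 (3.53) p.280] -/
theorem comp_mem_Ucj_witness (P : Params) (i : ℕ) :
    let c := consts (((P.d : ℝ) - 1) * (1 * C311 (1 : ℝ)))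
    let Fr := frameOf fullModel c (trivData (𝔸 := 𝔸) P i)
    Fr.comp unitPair (0 : PBond P i → 𝔸) 0 (0 : PBond P i → 𝔸) ∈ Fr.Ucj c.α₀ c.α₁ := by
  intro c Fr
  obtain ⟨hU, hA, hB⟩ := domain_nonempty (𝔸 := 𝔸) P i
  exact ((lemma4Printed_trivData (𝔸 := 𝔸) P i) (lemma4Restrictions_consts (coefD_nonneg P))).1 unitPair
    (0 : PBond P i → 𝔸) 0 (0 : PBond P i → 𝔸) hU hA le_rfl zero_le_one hB

/-- **NON-VACUITY CERTIFICATE for the by-reference package of Lemma 4**: for every complete normed ℂ-algebra `𝔸` with `‖1‖ = 1` and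
every torus `T^{(i)}` there are a model `𝓜`, constants `c` satisfying «all the restrictions» and a package `D : Lemma4Data P i 𝓜 c`
whose printed domain U′ᶜ_{k+1}(□₀, (1+2β)α₀, (1+2β)α₁) × (3.31) × {|B′| < α₃} is inhabited — so
`B12Lemma4ConcreteFrame.lemma4Printed_frameOf` is not a statement about an empty hypothesis structure.
[cite: Balaban1987RG1, Lemma 4 (3.53) p.280] -/
theorem lemma4Data_nonvacuous (P : Params) (i : ℕ) :
    ∃ (𝓜 : Model 𝔸) (c : B12Sec2to5.Lemma4Consts) (D : Lemma4Data P i 𝓜 c),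
      B12Sec2to5.Lemma4Restrictions c ∧ B12Sec2to5.Lemma4Printed (frameOf 𝓜 c D) c ∧
        ∃ (U : FieldPair P i 𝔸ˣ 𝔸) (A B' : PBond P i → 𝔸),
          U ∈ (frameOf 𝓜 c D).Uprime ((1 + 2 * c.β) * c.α₀) ((1 + 2 * c.β) * c.α₁) ∧ A ∈ (frameOf 𝓜 c D).A331 ∧
            (frameOf 𝓜 c D).normB B' < c.α₃ ∧ (frameOf 𝓜 c D).comp U A 0 B' ∈ (frameOf 𝓜 c D).Ucj c.α₀ c.α₁ := by
  obtain ⟨hU, hA, hB⟩ := domain_nonempty (𝔸 := 𝔸) P i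
  exact ⟨fullModel, _, trivData P i, lemma4Restrictions_consts (coefD_nonneg P), lemma4Printed_trivData P i, unitPair,
    (0 : PBond P i → 𝔸), (0 : PBond P i → 𝔸), hU, hA, hB, comp_mem_Ucj_witness P i⟩

end Nonvacuity

end

end Literature.MathematicalPhysics.QuantumFieldTheory.Balaban1983to89.B12Lemma4DataInstance
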